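import Literature.Topology.FourManifolds.CappellShanesonStandardMatrix
import Mathlib.RingTheory.Coprime.Lemmas
import Mathlib.RingTheory.Ideal.Operations
import HarnessLib

/-!
# Complementary standard ideals of Cappell–Shaneson triples (the open special pairs at traces 73, 75, 77)

For a triple `(c, d, n)` with `d ∣ fₙ(c)` write `fₙ(c) = -a d`, `a = csEntryA c d n` (the `(0,1)` entry of
`X_{c,d,n}`, Kim–Yamada 2023, Rem. 2.8; tree: `CappellShanesonStandardMatrix.lean`).  In any commutative
ring `R` containing a root `θ` of `fₙ` the ideals `⟨d, θ - c⟩` and `⟨a, θ - c⟩` multiply to the principal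
ideal `⟨θ - c⟩` as soon as `a` and `d` are coprime (`span_pair_mul_span_pair_csEntryA`).  In `ℤ[θₙ]` this
says that the standard ideals `I(c, d)` and `I(c, |a|)` lie in mutually INVERSE ideal classes
("complementary pair"); under the trace move `n ↦ n + k d` the complement changes by `a ↦ a + k c (c - 1)`
(`csEntryA_add_mul`).  The special classes of traces `73, 75, 77` that remain open pair up this way:
`θ₇₃ - 23 ↦ 145 · 171`, `θ₇₅ - 31 ↦ 197 · 203`, `θ₇₇ - 61 ↦ 253 · 217` (`csEntryA_open_pairs`).
Elementary support for the bundle `papers/SmoothPoincare4/cappell-shaneson-gompf-chains`, EXTENSIONS.md §9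
(what is NOT proved there: standardness of these open classes).  The general lemma is named
`span_pair_mul_span_pair_eq_span_singleton_of_isCoprime` to keep clear of the tree's (different, four-relation)
`Literature.Topology.FourManifolds.span_pair_mul_span_pair_eq_span_singleton` (`CappellShanesonClassNumberTwo.lean`).
-/

-- D-0017 layout `Summit.<Summit>.<Problem>…` repeats the summit name for single-problem summits (gate passes -Dweak.linter.dupNamespace=false under Summits/)
set_option linter.dupNamespace false

open Polynomial
open Literature.Topology.FourManifolds

namespace Summit.SmoothPoincare4.SmoothPoincare4.Theorems.CappellShanesonSpecialChains

/-- If `d m ∈ ⟨x⟩` and `d`, `m` are coprime then `⟨d, x⟩ · ⟨m, x⟩ = ⟨x⟩` (any commutative ring). [folklore] -/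
theorem span_pair_mul_span_pair_eq_span_singleton_of_isCoprime {R : Type*} [CommRing R] {d m x : R}
    (hcop : IsCoprime d m) (hdm : d * m ∈ Ideal.span {x}) :
    Ideal.span {d, x} * Ideal.span {m, x} = Ideal.span {x} := by
  apply le_antisymm
  · rw [Ideal.span_pair_mul_span_pair, Ideal.span_le]
    intro y hy
    simp only [Set.mem_insert_iff, Set.mem_singleton_iff] at hy
    rcases hy with rfl | rfl | rfl | rfl
    · exact hdm
    · exact Ideal.mem_span_singleton.mpr (dvd_mul_left x d)
    · exact Ideal.mem_span_singleton.mpr (dvd_mul_right x m)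
    · exact Ideal.mem_span_singleton.mpr (dvd_mul_right x x)
  · rw [Ideal.span_singleton_le_iff_mem]
    obtain ⟨u, v, huv⟩ := hcop
    have h1 : d * x ∈ Ideal.span {d, x} * Ideal.span {m, x} :=
      Ideal.mul_mem_mul (Ideal.subset_span (by simp)) (Ideal.subset_span (by simp))
    have h2 : x * m ∈ Ideal.span {d, x} * Ideal.span {m, x} :=
      Ideal.mul_mem_mul (Ideal.subset_span (by simp)) (Ideal.subset_span (by simp))
    suffices hx : u * (d * x) + v * (x * m) ∈ Ideal.span {d, x} * Ideal.span {m, x} by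
      convert hx using 2
      linear_combination (-x) * huv
    exact Ideal.add_mem _ (Ideal.mul_mem_left _ _ h1) (Ideal.mul_mem_left _ _ h2)

/-- **Complementary pair.**  `d ∣ fₙ(c)`, `a = csEntryA c d n` (`a d = -fₙ(c)`) coprime to `d`, `θ` a root of
`fₙ` in a commutative ring `R`: `⟨d, θ - c⟩ · ⟨a, θ - c⟩ = ⟨θ - c⟩`.  [folklore; Kim–Yamada 2023, Rem. 2.8 for `a`] -/
theorem span_pair_mul_span_pair_csEntryA {R : Type*} [CommRing R] {c d n : ℤ} (θ : R)
    (hθ : θ ^ 3 - (n : R) * θ ^ 2 + ((n : R) - 1) * θ - 1 = 0)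
    (h : d ∣ (csPoly n).eval c) (hcop : IsCoprime d (csEntryA c d n)) :
    Ideal.span {(d : R), θ - c} * Ideal.span {((csEntryA c d n : ℤ) : R), θ - c} =
      Ideal.span {θ - (c : R)} := by
  apply span_pair_mul_span_pair_eq_span_singleton_of_isCoprime
  · simpa using hcop.map (Int.castRingHom R)
  · have hda : (d : R) * ((csEntryA c d n : ℤ) : R) = -((((csPoly n).eval c : ℤ)) : R) := by
      rw [← Int.cast_mul, mul_comm, csEntryA_mul h, Int.cast_neg]
    rw [hda, eval_csPoly, Ideal.mem_span_singleton']
    refine ⟨θ ^ 2 + ((c : R) - n) * θ + ((c : R) ^ 2 - n * c + n - 1), ?_⟩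
    push_cast
    linear_combination hθ

/-- The complements of the open special representatives: `fₙ(c) = -a d` with
`(c,d,n; a)` = `(23,145,73; 171)`, `(23,171,73; 145)`, `(41,189,73; 269)`, `(31,197,75; 203)`, `(61,253,77; 217)`,
`(98,153,76; -1429)`, `(37,155,70; 275)`, `(101,163,75; -1673)`, `(34,145,77; 325)`, `(104,141,70; -2659)`,
`(116,141,76; -3879)` (`a < 0` exactly when `fₙ(c) > 0`). (bundle `papers/SmoothPoincare4/cappell-shaneson-gompf-chains`, EXTENSIONS.md §9). -/
theorem csEntryA_open_pairs :
    csEntryA 23 145 73 = 171 ∧ csEntryA 23 171 73 = 145 ∧ csEntryA 41 189 73 = 269 ∧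
    csEntryA 31 197 75 = 203 ∧ csEntryA 61 253 77 = 217 ∧ csEntryA 98 153 76 = -1429 ∧
    csEntryA 37 155 70 = 275 ∧ csEntryA 101 163 75 = -1673 ∧ csEntryA 34 145 77 = 325 ∧
    csEntryA 104 141 70 = -2659 ∧ csEntryA 116 141 76 = -3879 := by
  simp only [csEntryA, eval_csPoly]
  norm_num

/-- The coprimality side conditions for the five complementary pairs with coprime complements
(`gcd(d, a) = 1`): (145,171), (171,145), (189,269), (197,203), (253,217), (153,-1429). (bundle `papers/SmoothPoincare4/cappell-shaneson-gompf-chains`). -/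
theorem isCoprime_open_pairs :
    IsCoprime (145 : ℤ) 171 ∧ IsCoprime (171 : ℤ) 145 ∧ IsCoprime (189 : ℤ) 269 ∧
    IsCoprime (197 : ℤ) 203 ∧ IsCoprime (253 : ℤ) 217 ∧ IsCoprime (153 : ℤ) (-1429) := by
  simp only [Int.isCoprime_iff_gcd_eq_one]
  decide

end Summit.SmoothPoincare4.SmoothPoincare4.Theorems.CappellShanesonSpecialChains
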